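import Summits.BirchSwinnertonDyer.Rank1Residual.ManinAdditive.TwoEisensteinRankExists
import Literature.NumberTheory.EllipticCurves.NewformsStrongMultiplicityOne
import Literature.NumberTheory.EllipticCurves.NewformsMultiplicityOneProofs
import HarnessLib

/-!
# The OLDFORM edge at the Eisenstein prime `2`: `TwoPNoTwoEisenstein ⟹` no 2-Eisenstein congruence at level `p`
# (`p ≡ ±3 (mod 8)`), and the MAZUR-FREE chain **E-imc-94 ∧ E-imc-81 ⟹ E-imc-85**

Summit `BirchSwinnertonDyer`, route `ManinLocalTwoThree`, crux C2 `ManinOddAtFour` (stmt-BirchSwinnertonDyer-22967), stub 6d;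
width seat `bsd-line-manin23-p2` (gen 8); cell `bsd-f2-manin`, planner-of-record imc g17 typing ask T-imc-17 («oldform-inclusion
edge `TwoPNoTwoEisenstein → (p ≡ ±3 (8)) TwoEisensteinRankEq p 0` removing hMazur»).

PROVED here (sorry-free): a 2-Eisenstein-nilpotent integral form `g` of level `p` pushes forward under the degeneracy map
`ι₁ : S₂(Γ₀(p)) → S₂(Γ₀(2p))` (same `q`-expansion, `T_ℓ`-equivariant for `ℓ ∤ 2p`) to a nilpotent form of level `2p`; if
that is twice integral then so is `g` (halve the coefficients).  Hence `TwoPNoTwoEisenstein` gives `TwoEisensteinRankEq p 0` for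
every prime `p ≡ ±3 (mod 8)` (`twoEisensteinRankEq_prime_zero_of_twoP`), and the chain E-94 ∧ E-81 ⟹ E-85
(`fourPTwoEisensteinRankOne_of_rankLaw_of_twoP`) needs NEITHER Mazur's level-`p` theorem NOR `hex`.
BSD is not proved by this; Manin's conjecture is not proved by this.
-/

set_option autoImplicit false
-- `Summit.BirchSwinnertonDyer.BirchSwinnertonDyer` is the mandated summit-side namespace (single-conjunct summit).
set_option linter.dupNamespace false

noncomputable section

open scoped MatrixGroups
open CongruenceSubgroup
open Literature.NumberTheory.EllipticCurves Literature.NumberTheory.EllipticCurves.ModularForms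
open Summit.BirchSwinnertonDyer.Rank1Residual.ManinAdditive.TwoEisenstein

namespace Summit.BirchSwinnertonDyer.BirchSwinnertonDyer.Theorems.ManinLocalTwoThree

/-- `q`-expansion coefficients are unchanged by the level-raising degeneracy map `ι₁`. -/
theorem cuspCoeff_degeneracyMap0_one {M L : ℕ} [NeZero M] [NeZero L] (h : M ∣ L) (g : CuspForm (Gamma0 M) 2) (n : ℕ) :
    cuspCoeff (degeneracyMap0 M L 1 2 g) n = cuspCoeff g n := by
  simp only [cuspCoeff, qExpansion_degeneracyMap0_one M L 2 h g]

/-- `ι₁` maps `S₂(Γ₀(M); ℤ)` into `S₂(Γ₀(L); ℤ)`. -/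
theorem degeneracyMap0_one_mem_integralCuspForms0 {M L : ℕ} [NeZero M] [NeZero L] (h : M ∣ L) {g : CuspForm (Gamma0 M) 2}
    (hg : g ∈ integralCuspForms0 M 2) : degeneracyMap0 M L 1 2 g ∈ integralCuspForms0 L 2 := by
  rw [mem_integralCuspForms0] at hg ⊢
  intro n
  rw [cuspCoeff_degeneracyMap0_one h]
  exact hg n

/-- `T_ℓ`-powers commute with `ι₁` (`ℓ ∤ L` prime). -/
theorem heckeT_pow_degeneracyMap0_one {M L : ℕ} [NeZero M] [NeZero L] (h : M ∣ L) {ℓ : ℕ} [NeZero ℓ] (hℓ : ℓ.Prime)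
    (hℓL : ¬ ℓ ∣ L) (k : ℕ) (g : CuspForm (Gamma0 M) 2) :
    (heckeT (Gamma0 L) 2 ℓ ^ k) (degeneracyMap0 M L 1 2 g) = degeneracyMap0 M L 1 2 ((heckeT (Gamma0 M) 2 ℓ ^ k) g) := by
  have h1 : M * 1 ∣ L := by rwa [mul_one]
  induction k with
  | zero => simp
  | succ k ih => rw [pow_succ', Module.End.mul_apply, ih, heckeT_degeneracyMap0 h1 hℓ hℓL, pow_succ', Module.End.mul_apply]

/-- **A 2-Eisenstein-nilpotent form of level `p` pushes forward to one of level `2p`.** -/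
theorem isTwoEisensteinNilpotent_degeneracyMap0_one {p : ℕ} [NeZero p] [NeZero (2 * p)] {g : CuspForm (Gamma0 p) 2}
    (hg : IsTwoEisensteinNilpotent p g) : IsTwoEisensteinNilpotent (2 * p) (degeneracyMap0 p (2 * p) 1 2 g) := by
  have hdvd : p ∣ 2 * p := dvd_mul_left p 2
  refine ⟨degeneracyMap0_one_mem_integralCuspForms0 hdvd hg.1, fun ℓ hℓ hodd hℓN => ?_⟩
  haveI : NeZero ℓ := ⟨hℓ.ne_zero⟩
  have hℓp : ¬ ℓ ∣ p := fun hd => hℓN (hd.mul_left 2)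
  obtain ⟨n, h2, hh2, hn⟩ := hg.2 ℓ hℓ hodd hℓp
  refine ⟨n, degeneracyMap0 p (2 * p) 1 2 h2, degeneracyMap0_one_mem_integralCuspForms0 hdvd hh2, ?_⟩
  rw [heckeT_pow_degeneracyMap0_one hdvd hℓ hℓN n g, hn, map_smul]

/-- **Twice integral after `ι₁` ⟹ twice integral before**: if `ι₁ g ∈ 2·S₂(Γ₀(L); ℤ)` then `g ∈ 2·S₂(Γ₀(M); ℤ)` (halve the
coefficients). -/
theorem isTwiceIntegral_of_degeneracyMap0_one {M L : ℕ} [NeZero M] [NeZero L] (h : M ∣ L) {g : CuspForm (Gamma0 M) 2}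
    (hg : IsTwiceIntegral L (degeneracyMap0 M L 1 2 g)) : IsTwiceIntegral M g := by
  obtain ⟨h2, hh2, hg2⟩ := hg
  refine ⟨(1 / 2 : ℂ) • g, ?_, by rw [smul_smul]; norm_num⟩
  rw [mem_integralCuspForms0] at hh2 ⊢
  intro n
  obtain ⟨z, hz⟩ := hh2 n
  refine ⟨z, ?_⟩
  have hcoe : cuspCoeff g n = 2 * cuspCoeff h2 n := by
    rw [← cuspCoeff_degeneracyMap0_one h g n, hg2, cuspCoeff_smul]
  rw [cuspCoeff_smul, hcoe, ← hz]
  ring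

/-- **The oldform edge (T-imc-17): no 2-Eisenstein congruence at level `2p` ⟹ none at level `p`.** -/
theorem no_twoEisenstein_prime_of_twoP {p : ℕ} [NeZero p] [NeZero (2 * p)]
    (h2p : ∀ g : CuspForm (Gamma0 (2 * p)) 2, IsTwoEisensteinNilpotent (2 * p) g → IsTwiceIntegral (2 * p) g) :
    ∀ g : CuspForm (Gamma0 p) 2, IsTwoEisensteinNilpotent p g → IsTwiceIntegral p g :=
  fun _ hg => isTwiceIntegral_of_degeneracyMap0_one (dvd_mul_left p 2)
    (h2p _ (isTwoEisensteinNilpotent_degeneracyMap0_one hg))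

/-- **`TwoPNoTwoEisenstein ⟹ TwoEisensteinRankEq p 0` for every prime `p ≡ ±3 (mod 8)`** — Mazur's level-`p` theorem at
`ℓ = 2` becomes a CONSEQUENCE of E-imc-81 on these primes. -/
theorem twoEisensteinRankEq_prime_zero_of_twoP (h81 : TwoPNoTwoEisenstein) (p : ℕ) [NeZero p] (hp : p.Prime)
    (h8 : p % 8 = 3 ∨ p % 8 = 5) : TwoEisensteinRankEq p 0 := by
  haveI : NeZero (2 * p) := ⟨Nat.mul_ne_zero two_ne_zero hp.ne_zero⟩
  rw [twoEisensteinRankEq_zero_iff]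
  exact no_twoEisenstein_prime_of_twoP (h81 p hp h8)

/-- **E-imc-94 ∧ E-imc-81 ⟹ E-imc-85, with NO Mazur hypothesis and NO `hex`** (the stub-6d chain of `kato_shift_two` modulo
exactly the rank law E-94 and the generalized-Ogg input E-81). -/
theorem fourPTwoEisensteinRankOne_of_rankLaw_of_twoP (hlaw : FourPTwoPRankLaw) (h81 : TwoPNoTwoEisenstein) :
    FourPTwoEisensteinRankOne := by
  rw [fourPTwoEisensteinRankOne_iff_rankEq_one]
  intro p _ hp h5
  haveI : NeZero p := ⟨hp.ne_zero⟩

  haveI : NeZero (2 * p) := ⟨Nat.mul_ne_zero two_ne_zero hp.ne_zero⟩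
  have hp5 : 5 ≤ p := by
    have := hp.two_le
    omega
  have h0p : TwoEisensteinRankEq p 0 := twoEisensteinRankEq_prime_zero_of_twoP h81 p hp (Or.inr h5)
  have h02p : TwoEisensteinRankEq (2 * p) 0 := (twoEisensteinRankEq_zero_iff (2 * p)).mpr (h81 p hp (Or.inr h5))
  obtain ⟨r₄, hr₄⟩ := exists_twoEisensteinRankEq (4 * p)
  have key := hlaw p hp hp5 0 0 r₄ h0p h02p hr₄
  have h41 : p % 4 = 1 := by omega
  rw [if_pos h41] at key
  have : r₄ = 1 := by omega
  rw [← this]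
  exact hr₄

end Summit.BirchSwinnertonDyer.BirchSwinnertonDyer.Theorems.ManinLocalTwoThree

end
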